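import Summits.QuantumFields.BalabanUV.T4Continuum.Support.RegularTransportersPerBond
import Summits.QuantumFields.BalabanUV.T4Continuum.Support.NestedContourTransportContour

/-!
# T⁴ programme, spine node NE2 (U1a), tier B — ROW B5 FEED: the regularity class and node NE3 BY NAME supply the three transporter
# hypotheses of row B3.b-conc (ii)'s two-level law `NestedContourTransport.transport_contour_two_level`, at every tower level

NE2 formalisation swarm, leaf prover 03 (row B5 of `t4/formal/NE2/LEAVES.md`), on top of this seat's `Support/RegularTransportersPerBond`
(per-bond forms of the (3.35)-shape hypothesis structure `RegularBackgroundTower.RegularTransporters`) and leaf-06's LANDED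
`Support/NestedContourTransportContour` (row B3.b-conc (ii): the two-level consistency of the contour transporters, explicit constant
`thetaC L n d a′ a b`, hypotheses fine size `a′`, coarse size `a`, per-bond connection consistency `b`).  WHAT IS PROVED (bookkeeping only):
 * `norm_transporter_succ_sub_one_le` — the FINE SIZE at the next level in leaf-06's currency: `‖R^{(k+1)}_ν(x′) − 1‖ ≤ α/(L·n_k)`;
 * **`perBond_consistency_of_localRate`** — node NE3's `LocalRate` on the class `regClass R = {w, Dw}` (row B6 `NE2FromNE3.consistent_of_
   localRate_lev`, read on the connection tower `w = L^k(R − 1)`), divided by `L^{k+1}` (leaf-06's `consistency_div`), IS leaf-06's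
   hypothesis `hC` with `b_k = βNE3/(L·n_k²)`, `βNE3 = 2·card o·C`: `‖(R^{(k+1)}_ν(x′) − 1) − L⁻¹(R^{(k)}_ν(par x′) − 1)‖ ≤ βNE3/(L·n_k²)`;
 * **`transport_contour_two_level_of_regular`** — hence, from `(hreg : RegularTransporters L M R α β)` and
   `(hNE3 : LocalRate (bgReadings (regClass R)) C L⁻¹)` DISPLAYED AS BINDERS, leaf-06's END at the tower levels `n_k ← n_{k+1} = L·n_k`:
   the refined-contour transporter of `R^{(k+1)}` and the parent-contour transporter of `R^{(k)}` differ by at most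
   `thetaC L n_k d (α/(L·n_k)) (α/n_k) (βNE3/(L·n_k²))` — EXACTLY the argument triple of leaf-06's geometric bound `thetaC_le_theta0_div`
   (file 3, `θ₀(d, α, βNE3)/n_k`), i.e. the `hT2` datum of leaf-07's `averagingLaws_Ecov` (row B3.a′ (iii)) discharged down to `(hreg, hNE3)`;
 * `norm_transport_contour_sub_one_le_of_regular` — leaf-07's size datum `hTτ` from `hreg` alone, `τ = e^{(d+1)α} − 1`, k-UNIFORM, for
   every line position `s ≤ n_k` (the end-of-line value `s = n_k` included: `length_contour_le_of_le`).
So the transporter binders of the B3 chain (`hR` = `RegularTransportersPerBond.norm_transporter_sub_one_le`, `hT2`, `hTτ`) reduce to the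
two displayed binders `hreg`, `hNE3` of ROOT B BY NAME; the geometric closed form of `thetaC` is leaf-06's (row B3.b-conc (ii), file 3).

HONEST FRAMING (T4-DAG p. 1).  MODEL LEVEL (transporters are DATA; GLOBAL small field; no assertion that they are Bałaban's minimisers, no
dictionary B0, c5); the consistency is node NE3's OWN tree predicate consumed BY NAME (c2/c7) — nothing of NE3 is proved; finite torus,
operator norm; constants OURS; one input of row B3 of the NE2 skeleton; NOT [B9] (3.19)/(3.26) as printed; **NE2 NOT PROVED**; NOT infinite
volume, NOT a mass gap, NOT Clay, NOT summit progress; spine 0/9 unchanged.  HONEST DEPENDENCY: continuum YM on T⁴ ⇐ BetaPertH ∧ nine spine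
estimates (0/9 proved); BetaPertH ⇐ (D1) ∧ (D4) ∧ CAP+tail; G-an2-4 gates asym, D1 and NE2/3/4.  ABSOLUTE RULE kept; no `sorry`.
-/

noncomputable section

open scoped BigOperators ComplexConjugate Matrix Matrix.Norms.L2Operator

namespace Summit.QuantumFields.BalabanUV.T4Continuum.RegularTransportersContour

open Literature.MathematicalPhysics.QuantumFieldTheory.Balaban1983to89.B5Prop11Plancherel
open Literature.MathematicalPhysics.QuantumFieldTheory.Balaban1983to89.B5G183RateUnitTower (lev lev_neZero)
open Literature.MathematicalPhysics.QuantumFieldTheory.Balaban1983to89.T4EtaRateMin (LocalRate)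
open Summit.QuantumFields.BalabanUV.T4Continuum
open Summit.QuantumFields.BalabanUV.T4Continuum.BalabanAveragedTowerModes (par)
open Summit.QuantumFields.BalabanUV.T4Continuum.BalabanAveragedTowerUnit (idx one_le_lev' cast_lev' lev_succ')
open Summit.QuantumFields.BalabanUV.T4Continuum.BlockPairingGeometry
open Summit.QuantumFields.BalabanUV.T4Continuum.NE2FromNE3 (bgReadings consistent_of_localRate_lev)
open Summit.QuantumFields.BalabanUV.T4Continuum.CovariantBlockAveraging (transport contour)
open Summit.QuantumFields.BalabanUV.T4Continuum.LineAveragingPairing (glue)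
open Summit.QuantumFields.BalabanUV.T4Continuum.NestedContourTransport (thetaC transport_contour_two_level consistency_div)
open Summit.QuantumFields.BalabanUV.T4Continuum.RegularBackgroundTower
open Summit.QuantumFields.BalabanUV.T4Continuum.RegularTransportersPerBond (norm_transporter_sub_one_le)

variable {d : ℕ} {o : Type*} [Fintype o] [DecidableEq o]
variable {L : ℕ} [NeZero L] {M : Fin d → ℕ} [hM : ∀ μ, NeZero (M μ)]
variable {R : (k : ℕ) → Fin d → (idx L M k → Matrix o o ℂ)} {α β : ℝ}

omit [NeZero L] hM in
/-- the level factor at the next level, as a real number: `n_{k+1} = L·n_k`. [folklore] -/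
theorem cast_lev_succ (k : ℕ) : ((lev L (k + 1) : ℕ) : ℝ) = (L : ℝ) * (lev L k : ℕ) := by
  rw [lev_succ', Nat.cast_mul]

omit hM in
/-- **FINE SIZE IN THE `(L·n_k)⁻¹` CURRENCY**: `‖R^{(k+1)}_ν(x′) − 1‖ ≤ α/(L·n_k)` (leaf-06's `hR′` with `a′ = α/(L·n)`). [folklore] -/
theorem norm_transporter_succ_sub_one_le (h : RegularTransporters L M R α β) (k : ℕ) (ν : Fin d) (i : idx L M (k + 1)) :
    ‖R (k + 1) ν i - 1‖ ≤ α / ((L : ℝ) * (lev L k : ℕ)) := by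
  rw [← cast_lev_succ]; exact norm_transporter_sub_one_le h (k + 1) ν i

/-- **THE PER-BOND CONNECTION CONSISTENCY FROM NODE NE3 BY NAME**: `LocalRate (bgReadings (regClass R)) C L⁻¹` (row B6, read on the
connection tower `w = L^k(R − 1) ∈ regClass R`) gives leaf-06's hypothesis `hC` at the levels `n_k ← L·n_k` with `b = βNE3/(L·n_k²)`:
`‖(R^{(k+1)}_ν(x′, κ) − 1) − L⁻¹·(R^{(k)}_ν(par x′, κ) − 1)‖ ≤ 2·card o·C/(L·n_k²)`.  Nothing of NE3 is proved: `hNE3` is a displayed binder.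
[folklore] -/
theorem perBond_consistency_of_localRate {C : ℝ} (hC : 0 ≤ C) (hNE3 : LocalRate (bgReadings L M (regClass L M R)) C ((L : ℝ)⁻¹))
    (k : ℕ) (ν : Fin d) (x' : Tor (fine (L * lev L k) M)) (κ : Fin d) :
    ‖(R (k + 1) ν (x', κ) - 1) - ((L : ℂ))⁻¹ • (R k ν (par (lev L k) L M x', κ) - 1)‖
      ≤ betaNE3 o C / ((L : ℝ) * ((lev L k : ℕ) : ℝ) ^ 2) := by
  have hw := consistent_of_localRate_lev L M hC hNE3 (Set.mem_insert _ _ : connTower L M R ∈ regClass L M R) k ν (x', κ)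
  rw [connTower_eq, connTower_eq] at hw
  have hne : ((lev L (k + 1) : ℕ) : ℂ) ≠ 0 := by exact_mod_cast (NeZero.ne (lev L (k + 1)))
  have hc' : ((lev L (k + 1) : ℕ) : ℂ) = (L : ℂ) * ((lev L k : ℕ) : ℂ) := by rw [lev_succ', Nat.cast_mul]
  have h := consistency_div L hc' hne (R (k + 1) ν (x', κ)) (R k ν (par (lev L k) L M x', κ)) hw
  refine h.trans (le_of_eq ?_)
  rw [Complex.norm_natCast, cast_lev_succ, betaNE3]
  have hlev : (0 : ℝ) < (lev L k : ℕ) := lev_pos L k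
  have hL : (0 : ℝ) < L := by
    have := lev_pos L 1
    rw [cast_lev_succ] at this
    simpa [lev] using this
  field_simp

/-- **ROW B3.b-conc (ii)'s TWO-LEVEL LAW AT THE TOWER LEVELS, FROM THE REGULARITY CLASS AND NODE NE3 BY NAME** (leaf-06's
`transport_contour_two_level` with `R′ = R^{(k+1)}`, `R = R^{(k)}`, `n = n_k`): for every block base `y`, colour slot `μ`, coarse offset `j`,
sub-block offset `r` and `t′ < L·n_k`, the refined-contour transporter and the parent-contour transporter differ by at most
`thetaC L n_k d (α/(L·n_k)) (α/n_k) (βNE3/(L·n_k²))` — the argument triple of leaf-06's `thetaC_le_theta0_div`.  Binders `hreg` (row B5's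
(3.35)-shape class) and `hNE3` (node NE3's `LocalRate`, OPEN, consumed by name) DISPLAYED; NE2 is NOT proved by this. [folklore] -/
theorem transport_contour_two_level_of_regular (hreg : RegularTransporters L M R α β) {C : ℝ} (hC : 0 ≤ C)
    (hNE3 : LocalRate (bgReadings L M (regClass L M R)) C ((L : ℝ)⁻¹)) (k : ℕ) (y : Tor M) (μ : Fin d)
    (j : Fin d → Fin (lev L k)) (r : Fin d → Fin L) (t' : ℕ) (ht' : t' < L * lev L k) :
    ‖transport (fine (L * lev L k) M) (R (k + 1)) μ (contour (L * lev L k) M y (glue (lev L k) L (j, r)) μ t')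
        - transport (fine (lev L k) M) (R k) μ (contour (lev L k) M y j μ (((r μ : ℕ) + t') / L))‖
      ≤ thetaC L (lev L k) d (α / ((L : ℝ) * (lev L k : ℕ))) (α / (lev L k : ℕ)) (betaNE3 o C / ((L : ℝ) * ((lev L k : ℕ) : ℝ) ^ 2)) := by
  obtain ⟨hα, hβ⟩ := hreg.nonneg
  have hb : 0 ≤ betaNE3 o C / ((L : ℝ) * ((lev L k : ℕ) : ℝ) ^ 2) := by unfold betaNE3; positivity
  exact transport_contour_two_level (lev L k) L M (by positivity) (by positivity) hb
    (fun ν i => norm_transporter_succ_sub_one_le hreg k ν i) (fun ν i => norm_transporter_sub_one_le hreg k ν i)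
    (fun ν x' κ => perBond_consistency_of_localRate hC hNE3 k ν x' κ) y μ j r t' ht'

/-! ## The size of the contour transporters (leaf-07's `hTτ`, row B3.a′ (iii)) from the per-bond size -/

omit hM in
/-- the contour to the `s`-th line bond has at most `(d+1)·n` bonds also for the END-OF-LINE value `s = n` (leaf-07's
`length_contour_le` covers `s < n`). [folklore] -/
theorem length_contour_le_of_le (n : ℕ) [NeZero n] (y : Tor M) (j : Fin d → Fin n) (μ : Fin d) {s : ℕ} (hs : s ≤ n) :
    (contour n M y j μ s).length ≤ (d + 1) * n := by
  rw [contour, List.length_append, List.length_flatMap, CovariantBlockAveraging.length_leg]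
  have h1 : (List.map (fun ν : Fin d => (CovariantBlockAveraging.leg n M ν (CovariantBlockAveraging.corner n M y j (ν : ℕ))
      (j ν : ℕ)).length) (List.finRange d)).sum ≤ d * n := by
    have h2 : ∀ x ∈ List.map (fun ν : Fin d => (CovariantBlockAveraging.leg n M ν (CovariantBlockAveraging.corner n M y j (ν : ℕ))
        (j ν : ℕ)).length) (List.finRange d), x ≤ n := by
      intro x hx
      obtain ⟨ν, _, rfl⟩ := List.mem_map.mp hx
      rw [CovariantBlockAveraging.length_leg]; exact (j ν).is_lt.le
    have h3 := List.sum_le_card_nsmul _ n h2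
    rw [List.length_map, List.length_finRange, smul_eq_mul] at h3
    exact h3
  calc _ ≤ d * n + n := add_le_add h1 hs
    _ = (d + 1) * n := by ring

omit hM in
/-- **THE SIZE OF THE CONTOUR TRANSPORTERS FROM THE REGULARITY CLASS** (leaf-07's `hTτ` at every level, `τ = e^{(d+1)α} − 1`,
k-UNIFORM): `‖R^{(k)}(Γ_{y, x} ∪ [x, x + s·e_μ]) − 1‖ ≤ e^{(d+1)α} − 1` for every `s ≤ n_k` (per-bond size `α/n_k`, at most `(d+1)·n_k`
bonds, `(1 + α/n)^{(d+1)n} ≤ e^{(d+1)α}`). [folklore] -/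
theorem norm_transport_contour_sub_one_le_of_regular (hreg : RegularTransporters L M R α β) (k : ℕ) (y : Tor M) (μ : Fin d)
    (j : Fin d → Fin (lev L k)) {s : ℕ} (hs : s ≤ lev L k) :
    ‖transport (fine (lev L k) M) (R k) μ (contour (lev L k) M y j μ s) - 1‖ ≤ Real.exp ((d + 1 : ℕ) * α) - 1 := by
  have hα := hreg.nonneg.1
  have hn : 0 < lev L k := one_le_lev' L k
  exact (CovariantBlockAveraging.norm_transport_sub_one_le (fine (lev L k) M) (by positivity)
    (fun ν i => norm_transporter_sub_one_le hreg k ν i) μ (length_contour_le_of_le (lev L k) y j μ hs)).trans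
    (CovariantBlockAveraging.pow_sub_one_le_exp hα (d + 1) (lev L k) hn)

end Summit.QuantumFields.BalabanUV.T4Continuum.RegularTransportersContour

end
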